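import Literature.MathematicalPhysics.KineticTheory.LinearisedPhononCollisionOperator
import Literature.Analysis.FluidPDE.OseenSchemeRealAnalytic
import Mathlib.Analysis.SpecialFunctions.Complex.Analytic
import Mathlib.Analysis.SpecialFunctions.Trigonometric.Deriv
import Mathlib.Analysis.Analytic.IsolatedZeros
import Mathlib.Analysis.Analytic.Uniqueness
import HarnessLib

/-!
# Finiteness of the resonant fibres of the pinned band

Topic `Literature/MathematicalPhysics/KineticTheory`; proofs-only companion of
`LinearisedPhononCollisionOperator.lean`, whose module docstring asserts without proof: "For
`k₁ - k₃ ∉ 2πℤ` the zero set is finite (`k₂ ↦ Ω` is a non-constant real-analytic periodic function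
when `ω₂ > 0`)". Here this is PROVED (`resonantSet_finite`): for `ω₂ > 0` and `k₁ ≠ k₃` in the
cell `(-π, π]` the set `resonantSet ω₂ k₁ k₃` of partner momenta `k₂ ∈ (-π, π]` with
`Ω(k₁, k₂, k₃) = ω(k₁) + ω(k₂) - ω(k₃) - ω(k₁ + k₂ - k₃) = 0` is finite, so the resolved energy
delta `∑ᶠ k₂ ∈ resonantSet …` in `linearisedPhononCollisionOperator` / `collisionForm` /
`PhononBoltzmann.boltzmannForm` is a genuine finite sum off the diagonal (the `finsum` junk value
`0` on infinite sets is never met for `k₁ ≠ k₃`), and finite-sum algebra (monotonicity, splitting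
of the exchange zero) is available to users — e.g. the odd-sector gap crux `FGRGap` of
`AtomisticToContinuum/FouriersLaw` and the vertex-comparison lemmas of the `MourreDissolution`
disproof file.

## Proof

`ω(k) = √(ω₂ + 2(1 - cos k))` is real-analytic for `ω₂ > 0` (radicand `≥ ω₂ > 0`; analyticity of
`√` on `(0, ∞)` is reused from `Literature.Analysis.FluidPDE.analyticAt_sqrt`),
hence so is `k₂ ↦ Ω(k₁, k₂, k₃)`; it does not vanish identically: with `c = k₁ - k₃`,
`Ω(k₁, -c/2, k₃) = ω(k₁) - ω(k₃)` (evenness of `ω`) and `Ω(k₁, 0, k₃) = ω(k₁) - ω(k₃) + √ω₂ - ω(c)`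
cannot both vanish because `cos c < 1` for `0 < |c| < 2π`; zeros of a not identically vanishing
analytic function on `ℝ` are isolated (identity principle), so finitely many lie in the compact
`[-π, π]` (finite subcover).

## References

* [ALS06] K. Aoki, J. Lukkarinen, H. Spohn, *Energy transport in weakly anharmonic chains*,
  J. Stat. Phys. 124 (2006) 1105–1129, §4 (4.2)–(4.6) (the solution manifold: exchange zeros and
  the non-perturbative branch `h`). [cite: AokiLukkarinenSpohn2006, §4 eqs. (4.2)-(4.6)]
-/

noncomputable section

open Set Real Filter
open _root_.Topology

namespace Literature.MathematicalPhysics.KineticTheory.PhononBoltzmann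

/-- The pinned band `ω(k) = √(ω₂ + 2(1 - cos k))` is real-analytic when `ω₂ > 0` (the radicand stays
`≥ ω₂ > 0`). [folklore] -/
theorem analyticAt_dispersion {ω₂ : ℝ} (hω : 0 < ω₂) (k : ℝ) : AnalyticAt ℝ (dispersion ω₂) k := by
  have hpos : 0 < ω₂ + 2 * (1 - Real.cos k) := by
    have := two_mul_one_sub_cos_nonneg k
    linarith
  have h1 : AnalyticAt ℝ (fun k : ℝ => ω₂ + 2 * (1 - Real.cos k)) k := by fun_prop
  exact (Literature.Analysis.FluidPDE.analyticAt_sqrt hpos).comp_of_eq h1 rfl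

/-- The resonance function `k₂ ↦ Ω(k₁, k₂, k₃)` is real-analytic (`ω₂ > 0`). [folklore] -/
theorem analyticAt_resonanceFn {ω₂ : ℝ} (hω : 0 < ω₂) (k₁ k₃ k₂ : ℝ) :
    AnalyticAt ℝ (fun q => resonanceFn ω₂ k₁ q k₃) k₂ := by
  unfold resonanceFn
  have h2 := analyticAt_dispersion hω k₂
  have h4 : AnalyticAt ℝ (fun q : ℝ => dispersion ω₂ (k₁ + q - k₃)) k₂ := by
    have hlin : AnalyticAt ℝ (fun q : ℝ => k₁ + q - k₃) k₂ := by fun_prop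
    exact (analyticAt_dispersion hω (k₁ + k₂ - k₃)).comp_of_eq hlin rfl
  exact ((analyticAt_const.add h2).sub analyticAt_const).sub h4

/-- Zeros of an everywhere real-analytic function that does not vanish identically are finite on
every compact set (isolated zeros by the identity principle on the connected line, then a finite
subcover). [folklore] -/
theorem finite_zeros_of_analyticAt {f : ℝ → ℝ} (hf : ∀ x, AnalyticAt ℝ f x) {x₀ : ℝ}
    (hx₀ : f x₀ ≠ 0) {K : Set ℝ} (hK : IsCompact K) : {x | x ∈ K ∧ f x = 0}.Finite := by
  have hU : ∀ z : ℝ, {w : ℝ | w ≠ z → f w ≠ 0} ∈ 𝓝 z := by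
    intro z
    rcases (hf z).eventually_eq_zero_or_eventually_ne_zero with h | h
    · exfalso
      have hall := AnalyticOnNhd.eqOn_zero_of_preconnected_of_eventuallyEq_zero
        (f := f) (U := univ) (fun x _ => hf x) isPreconnected_univ (mem_univ z) h
      exact hx₀ (hall (mem_univ x₀))
    · exact eventually_nhdsWithin_iff.1 h
  obtain ⟨t, -, hcover⟩ :=
    hK.elim_nhds_subcover (fun z => {w : ℝ | w ≠ z → f w ≠ 0}) (fun z _ => hU z)
  refine t.finite_toSet.subset ?_
  rintro x ⟨hxK, hfx⟩
  have hx := hcover hxK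
  simp only [mem_iUnion] at hx
  obtain ⟨z, hzt, hz⟩ := hx
  have hxz : x = z := by
    by_contra hne
    exact hz hne hfx
  rw [hxz]
  exact hzt

/-- On the Brillouin cell, distinct momenta have `cos(k₁ - k₃) < 1` (`0 < |k₁ - k₃| < 2π`).
[folklore] -/
theorem cos_sub_lt_one_of_mem_Ioc {k₁ k₃ : ℝ} (hk₁ : k₁ ∈ Ioc (-π) π) (hk₃ : k₃ ∈ Ioc (-π) π)
    (hne : k₁ ≠ k₃) : Real.cos (k₁ - k₃) < 1 := by
  refine lt_of_le_of_ne (Real.cos_le_one _) fun h => ?_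
  obtain ⟨n, hn⟩ := (Real.cos_eq_one_iff _).1 h
  have h1 : -π < k₁ := hk₁.1
  have h2 : k₁ ≤ π := hk₁.2
  have h3 : -π < k₃ := hk₃.1
  have h4 : k₃ ≤ π := hk₃.2
  have hlt : |(n : ℝ) * (2 * π)| < 2 * π := by
    rw [hn, abs_lt]
    constructor <;> linarith
  have hn0 : n = 0 := by
    by_contra hn0
    have h1n : (1 : ℝ) ≤ |(n : ℝ)| := by
      rw [← Int.cast_abs]
      exact_mod_cast Int.one_le_abs hn0
    have : 2 * π ≤ |(n : ℝ) * (2 * π)| := by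
      rw [abs_mul, abs_of_pos (by positivity : (0 : ℝ) < 2 * π)]
      nlinarith [Real.pi_pos]
    linarith
  subst hn0
  simp at hn
  exact hne (by linarith)

/-- **The non-degenerate resonant fibres of the pinned band are finite.** For `ω₂ > 0` and
`k₁ ≠ k₃` in `(-π, π]`, the set `resonantSet ω₂ k₁ k₃` of `k₂ ∈ (-π, π]` with
`ω(k₁) + ω(k₂) = ω(k₃) + ω(k₁ + k₂ - k₃)` is finite (it always contains the exchange zero `k₂ = k₃`
and, generically, the non-perturbative partner `h(k₁; k₃)` of ALS). Consequently the resolved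
energy delta in `linearisedPhononCollisionOperator`, `collisionForm` and `boltzmannForm` is a finite
sum for every off-diagonal `(k₁, k₃)`. [cite: AokiLukkarinenSpohn2006, §4 eqs. (4.2)-(4.6)] -/
theorem resonantSet_finite {ω₂ k₁ k₃ : ℝ} (hω : 0 < ω₂) (hk₁ : k₁ ∈ Ioc (-π) π)
    (hk₃ : k₃ ∈ Ioc (-π) π) (hne : k₁ ≠ k₃) : (resonantSet ω₂ k₁ k₃).Finite := by
  set c := k₁ - k₃ with hc
  have hcos : Real.cos c < 1 := cos_sub_lt_one_of_mem_Ioc hk₁ hk₃ hne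
  have hgap : dispersion ω₂ 0 < dispersion ω₂ c := by
    unfold dispersion
    rw [Real.cos_zero]
    apply Real.sqrt_lt_sqrt (by linarith)
    linarith
  have heven : dispersion ω₂ (-(c / 2)) = dispersion ω₂ (c - c / 2) := by
    rw [dispersion_neg, show c - c / 2 = c / 2 by ring]
  obtain ⟨x₀, hx₀⟩ : ∃ x₀ : ℝ, resonanceFn ω₂ k₁ x₀ k₃ ≠ 0 := by
    by_cases h : resonanceFn ω₂ k₁ (-(c / 2)) k₃ = 0
    · refine ⟨0, ?_⟩
      have h' : dispersion ω₂ k₁ - dispersion ω₂ k₃ = 0 := by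
        unfold resonanceFn at h
        rw [show k₁ + -(c / 2) - k₃ = c - c / 2 by rw [hc]; ring, ← heven] at h
        linarith
      unfold resonanceFn
      rw [add_zero, show k₁ - k₃ = c from rfl]
      intro h0
      linarith
    · exact ⟨_, h⟩
  have hfin := finite_zeros_of_analyticAt (fun x => analyticAt_resonanceFn hω k₁ k₃ x) hx₀
    (isCompact_Icc (a := -π) (b := π))
  refine hfin.subset ?_
  intro k₂ hk₂
  exact ⟨Ioc_subset_Icc_self hk₂.1, hk₂.2⟩

/-- The resonant fibre meets every set in a finite set off the diagonal — the form needed for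
`finsum_mem` algebra (`finsum_mem_add_distrib`, monotonicity) on the resolved energy delta.
[folklore] -/
theorem resonantSet_inter_finite {ω₂ k₁ k₃ : ℝ} (hω : 0 < ω₂) (hk₁ : k₁ ∈ Ioc (-π) π)
    (hk₃ : k₃ ∈ Ioc (-π) π) (hne : k₁ ≠ k₃) (s : Set ℝ) : (resonantSet ω₂ k₁ k₃ ∩ s).Finite :=
  (resonantSet_finite hω hk₁ hk₃ hne).subset inter_subset_left

end Literature.MathematicalPhysics.KineticTheory.PhononBoltzmann

end
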